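import Literature.MathematicalPhysics.QuantumLattice.Imbrie2016.WeylWindow
import Literature.MathematicalPhysics.QuantumLattice.Imbrie2016.DiscreteDegeneracy

/-!
# Imbrie (2016), Assumption LLA: the schema fails for DISCRETE coupling laws (audit-cell lemma M7/N4, now fully kernel-checked)

CITATION HEADER (lean-in-tree rule 2026-08-18). J. Z. Imbrie, *On many-body localization for quantum spin chains*,
J. Stat. Phys. **163** (2016) 998–1048, doi 10.1007/s10955-016-1508-x, arXiv:1403.7837 [ImbrieJSP2016]: eq. (1.1) (model
with + boundary conditions), p. 1000 (the laws have bounded DENSITIES supported in [−1, 1]), eq. (1.3) = (5.2) (Assumption LLA(ν, C)).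
Weyl's monotonicity theorem in counting form: R. Bhatia, *Matrix Analysis* (1997), Cor. III.2.6 (via the landed
`card_eigenvalues_le_le_card_of_forms` / `card_eigenvalues_lt_le_card_of_forms`).
WHAT IS PROVED (observations of the audit cell `pub-imbrie`, LLA.md §4 M7 / REPAIR-CENSUS N4 — NOT statements of the paper; the laws
below are OUTSIDE the paper's density hypothesis, so nothing here refutes LLA as Imbrie states it):
  * `smallGap_of_diagEnergy_eq` (reverse Weyl window): two distinct configurations with EQUAL γ = 0 energy force two eigenvalues
    of H(γ) within 2|γ| Σ_i |Γ_i| of each other;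
  * `smallGap_of_intCouplings`: with integer fields/bonds of modulus ≤ 1 and n ≥ 5 sites this always happens
    (pigeonhole `Discrete.exists_degenerate_pair` of `DiscreteDegeneracy.lean` + the bridge `diagEnergy_intCast`);
  * `boxMeasure_smallGap_eq_one_of_discrete`: if the laws of h_i and J_i are carried by {−1, 0, 1} (e.g. Bernoulli ±1) and those of
    Γ_i by [−1, 1], then for every box of n ≥ 5 sites and every δ > 2|γ| n:  P_γ(∃ α ≠ β : |E_α − E_β| < δ) = 1;
  * `not_LLA_of_discrete`, `exists_gamma0_forall_not_LLA_of_discrete`: hence for such laws, every ν > 0 and every C, the inequality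
    LLA_γ(ν, C) of eq. (1.3) FAILS for all sufficiently small γ > 0 (witness n = 5, δ = 11γ).
ROLE: shows that the bounded-density hypothesis of [ImbrieJSP2016] p. 1000 is load-bearing for LLA — the attraction LLA must exclude
comes from arithmetic coincidences of unperturbed energies, which densities dissolve at rate ρ₀δ per flipped site (`ZeroCoupling.lean`,
`WeylWindow.lean`). STATUS: unconditional theorems about a variant model; LLA under the paper's hypotheses remains open (cell verdict).
Unit b2b-imbrie-1-g3 (gen 3 of the LLA seat).
-/

noncomputable section
open _root_.MeasureTheory Matrix Finset Filter Topology
open scoped InnerProductSpace ENNReal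

namespace Literature.MathematicalPhysics.QuantumLattice.Imbrie2016

variable {n : ℕ}

/-! ## Reverse Weyl window: equal γ = 0 energies ⇒ a small gap of H(γ) -/

/-- **Reverse Weyl window (deterministic).** If two distinct configurations have equal γ = 0 energies, then H(γ) has two distinct
eigenvalue indices within 2|γ| Σ_i |Γ_i| (Weyl monotonicity of counting functions between H(0) and H(γ), Bhatia Cor. III.2.6).
Audit-cell lemma (LLA.md §4 M7, "the Weyl half"). [cite: ImbrieJSP2016, eq. (1.3)] -/
theorem smallGap_of_diagEnergy_eq {γ δ : ℝ} {p : Params n} {σ τ : Cfg n} (hne : σ ≠ τ)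
    (heq : diagEnergy p σ = diagEnergy p τ) (hδ : 2 * (|γ| * ∑ i, |p.Γ i|) < δ) : SmallGap γ δ p := by
  set t : ℝ := |γ| * ∑ i, |p.Γ i| with ht
  set v : ℝ := diagEnergy p σ with hv
  -- the two quadratic forms differ by at most t‖x‖²
  have hHB : H γ p = H 0 p + Matrix.of (offDiag γ p) := by rw [H_zero]; rfl
  have hform : ∀ x : EuclideanSpace ℝ (Cfg n),
      RCLike.re ⟪x, toEuclideanLin (H γ p) x⟫_ℝ = RCLike.re ⟪x, toEuclideanLin (H 0 p) x⟫_ℝ +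
        RCLike.re ⟪x, toEuclideanLin (Matrix.of (offDiag γ p)) x⟫_ℝ := by
    intro x
    rw [hHB, map_add, LinearMap.add_apply, inner_add_right, map_add]
  have hAB : ∀ x : EuclideanSpace ℝ (Cfg n), RCLike.re ⟪x, toEuclideanLin (H 0 p) x⟫_ℝ ≤
      RCLike.re ⟪x, toEuclideanLin (H γ p) x⟫_ℝ + t * ‖x‖ ^ 2 := by
    intro x
    have h1 := (abs_le.mp (abs_re_inner_offDiag_le γ p x)).1
    rw [hform]; linarith
  have hBA : ∀ x : EuclideanSpace ℝ (Cfg n), RCLike.re ⟪x, toEuclideanLin (H γ p) x⟫_ℝ ≤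
      RCLike.re ⟪x, toEuclideanLin (H 0 p) x⟫_ℝ + t * ‖x‖ ^ 2 := by
    intro x
    have h1 := (abs_le.mp (abs_re_inner_offDiag_le γ p x)).2
    rw [hform]; linarith
  -- configurations: the value v is taken at least twice
  have hcountCfg : (univ.filter fun σ' => diagEnergy p σ' < v).card + 2 ≤
      (univ.filter fun σ' => diagEnergy p σ' ≤ v).card := by
    have hsub : (univ.filter fun σ' => diagEnergy p σ' < v) ∪ {σ, τ} ⊆
        (univ.filter fun σ' => diagEnergy p σ' ≤ v) := by
      intro i hi'
      simp only [Finset.mem_union, Finset.mem_filter, Finset.mem_univ, true_and, Finset.mem_insert,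
        Finset.mem_singleton] at hi' ⊢
      rcases hi' with h | rfl | rfl
      · exact h.le
      · exact le_of_eq hv.symm
      · exact le_of_eq (heq.symm.trans hv.symm)
    have hdisj : Disjoint (univ.filter fun σ' => diagEnergy p σ' < v) {σ, τ} := by
      rw [Finset.disjoint_left]
      intro i hi1 hi2
      simp only [Finset.mem_filter, Finset.mem_univ, true_and] at hi1
      simp only [Finset.mem_insert, Finset.mem_singleton] at hi2
      rcases hi2 with rfl | rfl
      · exact absurd hi1 (not_lt.mpr hv.le)
      · exact absurd hi1 (not_lt.mpr (hv.trans heq).le)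
    calc (univ.filter fun σ' => diagEnergy p σ' < v).card + 2
        = ((univ.filter fun σ' => diagEnergy p σ' < v) ∪ {σ, τ}).card := by
          rw [Finset.card_union_of_disjoint hdisj, Finset.card_pair hne]
      _ ≤ _ := Finset.card_le_card hsub
  -- transfer to eigenvalue indices of H(0)
  have hC1 := card_filter_eigs_zero_eq p (fun w => w ≤ v)
  have hC2 := card_filter_eigs_zero_eq p (fun w => w < v)
  -- Weyl monotonicity in both directions
  have hW1 : (univ.filter fun i => eigs 0 p i ≤ v).card ≤ (univ.filter fun i => eigs γ p i ≤ v + t).card :=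
    card_eigenvalues_le_le_card_of_forms (H_isHermitian 0 p) (H_isHermitian γ p) hBA v
  have hW2 : (univ.filter fun i => eigs γ p i < v - t).card ≤ (univ.filter fun i => eigs 0 p i < v).card := by
    have := card_eigenvalues_lt_le_card_of_forms (H_isHermitian γ p) (H_isHermitian 0 p) hAB (v - t)
    rw [sub_add_cancel] at this
    exact this
  have hwin : 1 < (univ.filter fun i => v - t ≤ eigs γ p i ∧ eigs γ p i ≤ v + t).card := by
    have hsub : (univ.filter fun i => eigs γ p i ≤ v + t) ⊆
        (univ.filter fun i => eigs γ p i < v - t) ∪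
          (univ.filter fun i => v - t ≤ eigs γ p i ∧ eigs γ p i ≤ v + t) := by
      intro i hi
      simp only [Finset.mem_union, Finset.mem_filter, Finset.mem_univ, true_and] at hi ⊢
      by_cases hlt' : eigs γ p i < v - t
      · exact Or.inl hlt'
      · exact Or.inr ⟨not_lt.mp hlt', hi⟩
    have := (Finset.card_le_card hsub).trans (Finset.card_union_le _ _)
    omega
  obtain ⟨α, hα, β, hβ, hαβ⟩ := Finset.one_lt_card.mp hwin
  simp only [Finset.mem_filter, Finset.mem_univ, true_and] at hα hβ
  refine ⟨α, β, hαβ, ?_⟩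
  rw [abs_lt]
  constructor <;> linarith [hα.1, hα.2, hβ.1, hβ.2]

/-! ## Bridge to the integer energies of `DiscreteDegeneracy.lean` -/

/-- the ℤ-indexed S^z with + b.c. agrees with `Discrete.ext` on natural indices. [cite: ImbrieJSP2016, eq. (1.1)] -/
theorem szZ_natCast (σ : Cfg n) (k : ℕ) : szZ σ (k : ℤ) = (Discrete.ext n σ k : ℝ) := by
  unfold szZ Discrete.ext
  by_cases hk : k < n
  · have h : (0 : ℤ) ≤ (k : ℤ) ∧ (k : ℤ) < n := ⟨by positivity, by exact_mod_cast hk⟩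
    rw [dif_pos h, dif_pos hk]
    have e : (⟨((k : ℤ)).toNat, by omega⟩ : Fin n) = ⟨k, hk⟩ := by ext; simp
    rw [e]
    rcases Bool.eq_false_or_eq_true (σ ⟨k, hk⟩) with e | e <;> simp [Discrete.spin, e]
  · have h : ¬ ((0 : ℤ) ≤ (k : ℤ) ∧ (k : ℤ) < n) := fun h' => hk (by exact_mod_cast h'.2)
    rw [dif_neg h, dif_neg hk]
    simp

/-- the left end of bond b (site b − 1, frozen to +1 for b = 0) through `szZ` and through `Discrete.ext`.
[cite: ImbrieJSP2016, eq. (1.1)] -/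
theorem szZ_natCast_sub_one (σ : Cfg n) (b : ℕ) :
    szZ σ ((b : ℤ) - 1) = ((if b = 0 then (1 : ℤ) else Discrete.ext n σ (b - 1) : ℤ) : ℝ) := by
  by_cases hb : b = 0
  · subst hb
    rw [if_pos rfl]
    unfold szZ
    rw [dif_neg (by omega)]
    simp
  · rw [if_neg hb]
    have e : ((b : ℤ) - 1) = ((b - 1 : ℕ) : ℤ) := by omega
    rw [e, szZ_natCast]

/-- **Bridge.** With integer fields h and bonds J (cast to ℝ) the γ = 0 energy `diagEnergy` is the integer energy
`Discrete.energy` of `DiscreteDegeneracy.lean`. [cite: ImbrieJSP2016, eq. (1.1)] -/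
theorem diagEnergy_intCast (h : Fin n → ℤ) (Γ : Fin n → ℝ) (J : Fin (n + 1) → ℤ) (σ : Cfg n) :
    diagEnergy ⟨fun i => (h i : ℝ), Γ, fun b => (J b : ℝ)⟩ σ = (Discrete.energy n h J σ : ℝ) := by
  simp only [diagEnergy, Discrete.energy, Int.cast_add, Int.cast_sum, Int.cast_mul]
  congr 1
  · refine Finset.sum_congr rfl fun i _ => ?_
    have e1 : szZ σ (i : ℤ) = (Discrete.spin (σ i) : ℝ) := by
      rw [show ((i : ℤ)) = ((i : ℕ) : ℤ) from rfl, szZ_natCast]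
      unfold Discrete.ext
      rw [dif_pos i.2]
    rw [e1]
  · refine Finset.sum_congr rfl fun b _ => ?_
    rw [show ((b : ℤ)) = ((b : ℕ) : ℤ) from rfl, szZ_natCast_sub_one, szZ_natCast]

/-- **Integer couplings force a small gap.** For integer fields/bonds of modulus ≤ 1, any transverse factors Γ, any γ and
n ≥ 5 sites, H(γ) has two eigenvalues within any δ > 2|γ| Σ_i |Γ_i| (pigeonhole `Discrete.exists_degenerate_pair` + the reverse
Weyl window). Audit-cell lemma (LLA.md §4 M7). [cite: ImbrieJSP2016, eq. (1.3)] -/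
theorem smallGap_of_intCouplings (hn : 5 ≤ n) (h : Fin n → ℤ) (J : Fin (n + 1) → ℤ) (hh : ∀ i, |h i| ≤ 1)
    (hJ : ∀ k, |J k| ≤ 1) (Γ : Fin n → ℝ) {γ δ : ℝ} (hδ : 2 * (|γ| * ∑ i, |Γ i|) < δ) :
    SmallGap γ δ ⟨fun i => (h i : ℝ), Γ, fun b => (J b : ℝ)⟩ := by
  obtain ⟨σ, τ, hne, hE⟩ := Discrete.exists_degenerate_pair n hn h J hh hJ
  refine smallGap_of_diagEnergy_eq hne ?_ hδ
  rw [diagEnergy_intCast, diagEnergy_intCast, hE]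

/-! ## Laws carried by {−1, 0, 1}: the LLA schema fails at every small γ -/

/-- a real number in {−1, 0, 1} is an integer of modulus ≤ 1. [folklore] -/
theorem exists_int_of_mem_signSet {x : ℝ} (hx : x ∈ ({-1, 0, 1} : Set ℝ)) :
    ∃ z : ℤ, |z| ≤ 1 ∧ (z : ℝ) = x := by
  simp only [Set.mem_insert_iff, Set.mem_singleton_iff] at hx
  rcases hx with rfl | rfl | rfl
  · exact ⟨-1, by simp, by simp⟩
  · exact ⟨0, by simp, by simp⟩
  · exact ⟨1, by simp, by simp⟩

/-- a finite product of laws each carried by a set s_i is carried by the cylinder ∀ i, g i ∈ s_i. [folklore] -/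
theorem pi_not_forall_mem_null {m : ℕ} {μ : Fin m → Measure ℝ} [∀ i, SigmaFinite (μ i)] {s : Fin m → Set ℝ}
    (hs : ∀ i, μ i (s i)ᶜ = 0) : Measure.pi μ {g | ¬ ∀ i, g i ∈ s i} = 0 := by
  have e : {g : Fin m → ℝ | ¬ ∀ i, g i ∈ s i} = ⋃ i, Function.eval i ⁻¹' (s i)ᶜ := by
    ext g; simp
  rw [e]
  exact measure_iUnion_null fun i => Measure.pi_eval_preimage_null _ (hs i)

/-- **P_γ(small gap) = 1 for discrete laws.** If the laws of the fields h_i and bonds J_i are carried by {−1, 0, 1}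
(e.g. Bernoulli ±1) and those of Γ_i by [−1, 1] (all probability measures), then for every box of n ≥ 5 sites, every γ and
every δ > 2|γ| n:  P_γ(∃ α ≠ β : |E_α − E_β| < δ) = 1. Such laws violate the density hypothesis of the paper (p. 1000).
Audit-cell lemma (LLA.md §4 M7 / REPAIR-CENSUS N4). [cite: ImbrieJSP2016, eq. (1.3)] -/
theorem boxMeasure_smallGap_eq_one_of_discrete {L : Laws}
    (hh : ∀ k, IsProbabilityMeasure (L.μh k) ∧ L.μh k ({-1, 0, 1} : Set ℝ)ᶜ = 0)
    (hΓ : ∀ k, IsProbabilityMeasure (L.μΓ k) ∧ L.μΓ k (Set.Icc (-1 : ℝ) 1)ᶜ = 0)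
    (hJ : ∀ k, IsProbabilityMeasure (L.μJ k) ∧ L.μJ k ({-1, 0, 1} : Set ℝ)ᶜ = 0)
    (a : ℤ) (hn : 5 ≤ n) {γ δ : ℝ} (hδ : 2 * |γ| * n < δ) :
    L.boxMeasure a n {t | SmallGap γ δ (Params.ofTriple t)} = 1 := by
  haveI : ∀ k, IsProbabilityMeasure (L.μh k) := fun k => (hh k).1
  haveI : ∀ k, IsProbabilityMeasure (L.μΓ k) := fun k => (hΓ k).1
  haveI : ∀ k, IsProbabilityMeasure (L.μJ k) := fun k => (hJ k).1
  haveI : IsProbabilityMeasure (L.boxMeasure a n) := by unfold Laws.boxMeasure; infer_instance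
  -- the full-measure set of "good" couplings
  set G : Set ((Fin n → ℝ) × (Fin n → ℝ) × (Fin (n + 1) → ℝ)) :=
    {t | (∀ i, t.1 i ∈ ({-1, 0, 1} : Set ℝ)) ∧ (∀ i, t.2.1 i ∈ Set.Icc (-1 : ℝ) 1) ∧
      ∀ b, t.2.2 b ∈ ({-1, 0, 1} : Set ℝ)} with hG
  have hGc : L.boxMeasure a n Gᶜ = 0 := by
    have hsub : Gᶜ ⊆ ({t | ¬ ∀ i, t.1 i ∈ ({-1, 0, 1} : Set ℝ)} ∪ {t | ¬ ∀ i, t.2.1 i ∈ Set.Icc (-1 : ℝ) 1}) ∪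
        {t | ¬ ∀ b, t.2.2 b ∈ ({-1, 0, 1} : Set ℝ)} := by
      intro t ht
      rw [hG, Set.mem_compl_iff, Set.mem_setOf_eq, not_and_or, not_and_or] at ht
      simp only [Set.mem_union, Set.mem_setOf_eq]
      tauto
    refine measure_mono_null hsub (measure_union_null (measure_union_null ?_ ?_) ?_)
    · have e : {t : (Fin n → ℝ) × (Fin n → ℝ) × (Fin (n + 1) → ℝ) | ¬ ∀ i, t.1 i ∈ ({-1, 0, 1} : Set ℝ)}
          = {g : Fin n → ℝ | ¬ ∀ i, g i ∈ ({-1, 0, 1} : Set ℝ)} ×ˢ Set.univ := by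
        ext t; simp only [Set.mem_setOf_eq, Set.mem_prod, Set.mem_univ, and_true]
      unfold Laws.boxMeasure
      rw [e, Measure.prod_prod, pi_not_forall_mem_null (fun i => (hh (a + i)).2), zero_mul]
    · have e : {t : (Fin n → ℝ) × (Fin n → ℝ) × (Fin (n + 1) → ℝ) | ¬ ∀ i, t.2.1 i ∈ Set.Icc (-1 : ℝ) 1}
          = Set.univ ×ˢ ({g : Fin n → ℝ | ¬ ∀ i, g i ∈ Set.Icc (-1 : ℝ) 1} ×ˢ Set.univ) := by
        ext t; simp only [Set.mem_setOf_eq, Set.mem_prod, Set.mem_univ, and_true, true_and]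
      unfold Laws.boxMeasure
      rw [e, Measure.prod_prod, Measure.prod_prod, pi_not_forall_mem_null (fun i => (hΓ (a + i)).2), zero_mul,
        mul_zero]
    · have e : {t : (Fin n → ℝ) × (Fin n → ℝ) × (Fin (n + 1) → ℝ) | ¬ ∀ b, t.2.2 b ∈ ({-1, 0, 1} : Set ℝ)}
          = Set.univ ×ˢ (Set.univ ×ˢ {g : Fin (n + 1) → ℝ | ¬ ∀ b, g b ∈ ({-1, 0, 1} : Set ℝ)}) := by
        ext t; simp only [Set.mem_setOf_eq, Set.mem_prod, Set.mem_univ, true_and]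
      unfold Laws.boxMeasure
      rw [e, Measure.prod_prod, Measure.prod_prod, pi_not_forall_mem_null (fun b => (hJ (a + b - 1)).2), mul_zero,
        mul_zero]
  -- on G the couplings are integers of modulus ≤ 1 and |Γ_i| ≤ 1, so the gap is small surely
  have hGS : G ⊆ {t | SmallGap γ δ (Params.ofTriple t)} := by
    intro t ht
    rw [hG] at ht
    obtain ⟨h1, h2, h3⟩ := ht
    choose hz hzabs hzeq using fun i => exists_int_of_mem_signSet (h1 i)
    choose Jz hJabs hJeq using fun b => exists_int_of_mem_signSet (h3 b)
    have e1 : t.1 = fun i => (hz i : ℝ) := funext fun i => (hzeq i).symm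
    have e2 : t.2.2 = fun b => (Jz b : ℝ) := funext fun b => (hJeq b).symm
    have eP : Params.ofTriple t = ⟨fun i => (hz i : ℝ), t.2.1, fun b => (Jz b : ℝ)⟩ := by
      unfold Params.ofTriple
      rw [e1, e2]
    rw [Set.mem_setOf_eq, eP]
    refine smallGap_of_intCouplings hn hz Jz hzabs hJabs t.2.1 (lt_of_le_of_lt ?_ hδ)
    have hsum : ∑ i, |t.2.1 i| ≤ n := by
      calc ∑ i, |t.2.1 i| ≤ ∑ _i : Fin n, (1 : ℝ) := Finset.sum_le_sum fun i _ => abs_le.mpr (h2 i)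
        _ = n := by simp
    nlinarith [abs_nonneg γ]
  refine le_antisymm prob_le_one ?_
  calc (1 : ℝ≥0∞) = L.boxMeasure a n Set.univ := measure_univ.symm
    _ ≤ L.boxMeasure a n G + L.boxMeasure a n Gᶜ := measure_univ_le_add_compl G
    _ = L.boxMeasure a n G := by rw [hGc, add_zero]
    _ ≤ L.boxMeasure a n {t | SmallGap γ δ (Params.ofTriple t)} := measure_mono hGS

/-- **The LLA schema fails for discrete laws at small γ** (witness n = 5, δ = 11γ): under the hypotheses of
`boxMeasure_smallGap_eq_one_of_discrete`, if (11γ)^ν C⁵ < 1 then ¬ LLA_γ(ν, C). Outside the paper's density hypothesis.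
Audit-cell lemma (LLA.md §4 M7 / REPAIR-CENSUS N4). [cite: ImbrieJSP2016, eq. (1.3)] -/
theorem not_LLA_of_discrete {L : Laws}
    (hh : ∀ k, IsProbabilityMeasure (L.μh k) ∧ L.μh k ({-1, 0, 1} : Set ℝ)ᶜ = 0)
    (hΓ : ∀ k, IsProbabilityMeasure (L.μΓ k) ∧ L.μΓ k (Set.Icc (-1 : ℝ) 1)ᶜ = 0)
    (hJ : ∀ k, IsProbabilityMeasure (L.μJ k) ∧ L.μJ k ({-1, 0, 1} : Set ℝ)ᶜ = 0)
    {ν C γ : ℝ} (hγ : 0 < γ) (hsmall : (11 * γ) ^ ν * C ^ 5 < 1) : ¬ LLA L γ ν C := by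
  intro hLLA
  have h1 := hLLA 0 5 (by norm_num) (11 * γ) (by positivity)
  have hδ : 2 * |γ| * ((5 : ℕ) : ℝ) < 11 * γ := by
    rw [abs_of_pos hγ]; push_cast; linarith
  rw [boxMeasure_smallGap_eq_one_of_discrete hh hΓ hJ 0 (le_refl 5) hδ] at h1
  exact absurd h1 (not_le.mpr (ENNReal.ofReal_lt_one.mpr hsmall))

/-- **Uniform failure at small coupling.** For laws as in `boxMeasure_smallGap_eq_one_of_discrete`, every ν > 0 and every C:
there is γ₀ > 0 such that LLA_γ(ν, C) fails for ALL γ ∈ (0, γ₀] — the opposite of what Thm 1.1 needs ("LLA for γ sufficiently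
small"), for a model violating only the density hypothesis. Audit-cell lemma (LLA.md §4 M7 / REPAIR-CENSUS N4).
[cite: ImbrieJSP2016, eq. (1.3)] -/
theorem exists_gamma0_forall_not_LLA_of_discrete {L : Laws}
    (hh : ∀ k, IsProbabilityMeasure (L.μh k) ∧ L.μh k ({-1, 0, 1} : Set ℝ)ᶜ = 0)
    (hΓ : ∀ k, IsProbabilityMeasure (L.μΓ k) ∧ L.μΓ k (Set.Icc (-1 : ℝ) 1)ᶜ = 0)
    (hJ : ∀ k, IsProbabilityMeasure (L.μJ k) ∧ L.μJ k ({-1, 0, 1} : Set ℝ)ᶜ = 0)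
    {ν : ℝ} (hν : 0 < ν) (C : ℝ) :
    ∃ γ₀ > 0, ∀ γ : ℝ, 0 < γ → γ ≤ γ₀ → ¬ LLA L γ ν C := by
  have ev : ∀ᶠ γ : ℝ in 𝓝[>] 0, (11 * γ) ^ ν * C ^ 5 < 1 := by
    have h1 : Tendsto (fun γ : ℝ => (11 ^ ν * C ^ 5) * γ ^ ν) (𝓝 0)
        (𝓝 ((11 ^ ν * C ^ 5) * (0 : ℝ) ^ ν)) :=
      ((Real.continuousAt_rpow_const 0 ν (Or.inr hν.le)).tendsto).const_mul _
    rw [Real.zero_rpow hν.ne', mul_zero] at h1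
    have h2 : ∀ᶠ γ : ℝ in 𝓝[>] 0, 11 ^ ν * C ^ 5 * γ ^ ν ≤ 1 / 2 :=
      (tendsto_nhdsWithin_of_tendsto_nhds h1).eventually_le_const (by norm_num)
    have ev0 : ∀ᶠ γ : ℝ in 𝓝[>] 0, 0 < γ := eventually_mem_nhdsWithin
    filter_upwards [h2, ev0] with γ hle hγ
    rw [Real.mul_rpow (by norm_num) hγ.le]
    linarith
  obtain ⟨γ₀, hγ₀, hsub⟩ := mem_nhdsGT_iff_exists_Ioc_subset.mp ev
  exact ⟨γ₀, hγ₀, fun γ hγ hle => not_LLA_of_discrete hh hΓ hJ hγ (hsub ⟨hγ, hle⟩)⟩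

end Literature.MathematicalPhysics.QuantumLattice.Imbrie2016
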